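import Summits.KontsevichZagierPeriods.KontsevichZagierPeriods.Theses.InequalityCost

/-!
# Crux `InequalityCost.TameCovLimit` (stmt-KontsevichZagierPeriods-8987) — birth skeleton (`Lines/birth.lean`)

Registered skeleton (planner, mode `skeleton-register`, route re-audit bin REPAIRABLE) for the rank-2 crux
`Summit.KontsevichZagierPeriods.KontsevichZagierPeriods.Theses.InequalityCost.TameCovLimit` of
route-KontsevichZagierPeriods-InequalityCost (TAME CLOSURE FOR RULE 2: `L¹`-limits at `t → 0⁺` of a tame
`ℚ`-semialgebraic family of change-of-variables instances are KZ-equivalent). Three named stubs and the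
kernel-checked composition `TameCovLimit_of : TameCovLimit`, whose body is the registered implication
`<stub_pointwiseLimit> → <stub_goodLocus> → <stub_aeCovAssembly> → TameCovLimit` (the `suffices`, a closed
term with no `sorry` of its own) applied to the three stubs BY NAME (shape required by `#h21_check_skeleton`:
conclusion = crux by name, no inline `Prop` hypotheses, sorries only inside `stub_*`).

## The line: STANDARD PART OF A TAME FAMILY OF CoV INSTANCES = ONE HONEST CoV MOVE ON THE GOOD LOCUS + NULL DEBRIS

Write `g_t = 1_{S_t} G(·,t)`, `g'_t = 1_{S'_t} G'(·,t)` (`t ∈ (0,1)`) for the extended fibre integrands and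
`φ_t = Φ(·,t)`.

1. `stub_pointwiseLimit` (size M, o-minimal limits + dominated convergence; no calculus of moves). A tame
   `ℚ`-semialgebraic family has a POINTWISE limit `g₀ = lim_{t→0⁺} g_t` at EVERY point (o-minimal monotonicity:
   for fixed `x` the function `t ↦ g_t x` is definable and bounded; tree `real_isOMinimal_holds`,
   `OMinimalLimits.tendsto_nhdsGT_or`), `g₀` is `∅`-definable hence `ℚ`-semialgebraic
   (`definable_iff_isSemialgebraic_real_holds`), bounded by `N` and supported in the box, and by dominated
   convergence (`|g_t| ≤ N·1_{[-N,N]ⁿ}`) it IS the `L¹`-limit: `1_{dom r₀} f₀ = g₀` a.e. This identifies the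
   abstract endpoint `r₀` of the crux with a concrete semialgebraic function.
2. `stub_goodLocus` (HARDEST, size L; the analytic heart = the route's foreseen `TameC1Limit` + `NullCollapse`).
   For the tame family of CoV instances with pointwise limits `g₀, g₀'` there is an OPEN `ℚ`-semialgebraic GOOD
   LOCUS `U ⊆ ℝⁿ` and a `ℚ`-semialgebraic `ψ` (the standard part `φ₀ = lim φ_t` on `U`) with semialgebraic
   Jacobian determinant, differentiable and injective on `U` with `det ψ' ≠ 0`, such that
   (I4) `g₀ = 0` a.e. off `U` (collapse: `|det ∂φ_t| → 0` forces `G_t = G'_t∘φ_t·|det| → 0` as `|G'| ≤ N`),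
   (I6) `g₀ x = g₀' (ψ x)·|det ψ' x|` a.e. on `U` (generic `C¹`-convergence `∂φ_t → ∂φ₀` of definable families —
   van den Dries 1998 Ch. 7, Coste 2000 §6 — and generic joint continuity of `(y,t) ↦ g'_t y` at `t = 0⁺`), and
   (I5) `g₀' = 0` a.e. off `ψ '' U` (expansion side; follows from (I4), (I6) and conservation of ABSOLUTE mass
   `∫|g'_t| = ∫|g_t|`, itself the area formula fibrewise). Injectivity of `ψ` on `U`: at generic points the
   convergence is locally `C¹`-uniform, so two preimages of one point would give overlapping images
   `φ_t(B(x₁,r)) ∩ φ_t(B(x₂,r)) ⊇ B(y,r')` for small `t`, contradicting `InjOn φ_t S_t`.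
3. `stub_aeCovAssembly` (size M; calculus of moves + measure theory, no o-minimality). From such an
   a.e.-change-of-variables configuration between the extended integrands of `r₀` and `r₀'` build the chain
   `r₀ ~ (U, (1_{D'}f')∘ψ·|det ψ'|) ~ (ψ '' U, 1_{D'} f') ~ r₀'`: the middle step is ONE honest instance of
   `KZ.changeOfVariablesRel` (integrability on `U` by `MeasureTheory.integrableOn_image_iff_integrableOn_abs_det_fderiv_smul`),
   the outer steps are a.e.-congruences (landed `Summit.KontsevichZagierPeriods.StandardParts.SpAeCongruence_proof`,
   Theorems/StandardPartsSpAeCongruence.lean) after discarding the null debris (I4), (I5); null sets pull back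
   under `ψ` by the area formula since `det ψ' ≠ 0` on `U`.

Composition (`TameCovLimit_of`): stub 1 for `(S,G,r₀)` and `(S',G',r₀')` gives `g₀, g₀'`; stub 2 gives
`U, ψ, ψ'`; stub 3 with `ρ := g₀`, `ρ' := g₀'` concludes `KZ.Equivalent r₀ r₀'`. Pure logic, no `sorry`.

Disproof used: none — `ledger crux ls stmt-KontsevichZagierPeriods-8987` showed no workfiles (no `Disproof.lean`,
no `Negative/` lemma) at registration, so there is no `_false_without_` obstruction to honour. Refuter notes on the
item (2026-08-15, g40-0/g40-31/g41-38/g41-51/g42-7): per-`t` instances satisfy Mathlib's area formula, so the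
endpoints always have equal value (the crux is summit-implied, unfalsifiable by values); in fibre dimension 1
degeneration can only COLLAPSE — consistent with (I4)–(I6).
-/

set_option linter.dupNamespace false

noncomputable section

open MeasureTheory Set Filter
open scoped Topology

namespace Summit.KontsevichZagierPeriods.KontsevichZagierPeriods.Cruxes.TameCovLimit.Birth

open Literature.NumberTheory.Transcendental Literature.NumberTheory.Transcendental.KZ
open Literature.ModelTheory.ExponentialFields (IsSemialgebraic)
open Summit.KontsevichZagierPeriods.KontsevichZagierPeriods.Theses.InequalityCost (TameCovLimit)

/-- **STUB 1 (`stub_pointwiseLimit`, size M) — the `L¹`-endpoint of a tame family is its pointwise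
o-minimal limit.** For a tame `ℚ`-semialgebraic family (`S ⊆ [-N,N]ⁿ⁺¹`, `|G| ≤ N` on `S`) the extended fibre
integrands `g_t = 1_{S_t} G(·,t)` converge at EVERY point as `t → 0⁺` to a `ℚ`-semialgebraic `g₀` with
`|g₀| ≤ N`, supported in the box `[-N,N]ⁿ`; and if `g_t → 1_{dom r₀} f₀` in `L¹` then `1_{dom r₀} f₀ = g₀`
almost everywhere (dominated convergence + uniqueness of `L¹` limits; both sides are integrable, so no junk
integral is involved). [van den Dries 1998, Ch. 3 (monotonicity), Ch. 1 §5 (definability of limits);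
BCR 1998, Prop. 2.2.4] -/
theorem stub_pointwiseLimit :
    ∀ ⦃n : ℕ⦄ (N : ℕ) (S : Set (Fin (n + 1) → ℝ)) (G : (Fin (n + 1) → ℝ) → ℝ)
      (r₀ : Literature.NumberTheory.Transcendental.KZ.IntegralRep n),
      Literature.ModelTheory.ExponentialFields.IsSemialgebraic ℚ S →
      Literature.NumberTheory.Transcendental.IsSemialgebraicFunOn ℚ S G →
      (∀ z ∈ S, (∀ i, |z i| ≤ N) ∧ |G z| ≤ N) →
      Filter.Tendsto (fun t : ℝ => ∫ x : Fin n → ℝ,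
          |{x : Fin n → ℝ | Fin.snoc x t ∈ S}.indicator (fun x => G (Fin.snoc x t)) x
            - r₀.domain.indicator r₀.integrand x|) (𝓝[>] (0:ℝ)) (𝓝 0) →
      ∃ g₀ : (Fin n → ℝ) → ℝ,
        Literature.NumberTheory.Transcendental.IsSemialgebraicFunOn ℚ Set.univ g₀ ∧
        (∀ x, |g₀ x| ≤ N) ∧ (∀ x, g₀ x ≠ 0 → ∀ i, |x i| ≤ N) ∧
        (∀ x : Fin n → ℝ, Filter.Tendsto
            (fun t : ℝ => {x : Fin n → ℝ | Fin.snoc x t ∈ S}.indicator (fun x => G (Fin.snoc x t)) x)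
            (𝓝[>] (0:ℝ)) (𝓝 (g₀ x))) ∧
        r₀.domain.indicator r₀.integrand =ᵐ[MeasureTheory.volume] g₀ := by
  sorry

/-- **STUB 2 (`stub_goodLocus`, HARDEST, size L) — standard part of a tame family of change-of-variables
instances: the good locus.** Given the tame `ℚ`-semialgebraic family of rule-2 instances of the crux
(fibrewise: `φ_t = Φ(·,t)` injective on `S_t` onto `S'_t`, differentiable within `S_t` with
`G_t = G'_t ∘ φ_t · |det L|`) and the pointwise limits `g₀, g₀'` of the extended fibre integrands on both
sides, there are an open `ℚ`-semialgebraic `U ⊆ ℝⁿ`, a `ℚ`-semialgebraic map `ψ` on `U` (the limit map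
`φ₀` restricted to its generic locus) and derivatives `ψ'` with `ℚ`-semialgebraic determinant such that `ψ`
is differentiable and injective on `U` with `det ψ' ≠ 0`, the source mass off `U` vanishes (collapse locus:
`|det ∂φ_t| → 0` and `|G'| ≤ N`), the target mass off `ψ '' U` vanishes (expansion locus: conservation of
absolute mass), and `g₀ = g₀' ∘ ψ · |det ψ'|` a.e. on `U` (generic `C¹`-convergence of definable families and
generic joint continuity at `t = 0⁺`). [van den Dries 1998, Ch. 7 §3 (generic smoothness), Ch. 6 (1.2);
Coste 2000, Thm. 6.? (cell decomposition `C¹`); Lion–Speissegger, doi:10.1007/s00029-004-0360-z] -/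
theorem stub_goodLocus :
    ∀ ⦃n : ℕ⦄ (N : ℕ) (S S' : Set (Fin (n + 1) → ℝ)) (G G' : (Fin (n + 1) → ℝ) → ℝ)
      (Φ : (Fin (n + 1) → ℝ) → (Fin n → ℝ)) (g₀ g₀' : (Fin n → ℝ) → ℝ),
      Literature.ModelTheory.ExponentialFields.IsSemialgebraic ℚ S →
      Literature.NumberTheory.Transcendental.IsSemialgebraicFunOn ℚ S G →
      Literature.ModelTheory.ExponentialFields.IsSemialgebraic ℚ S' →
      Literature.NumberTheory.Transcendental.IsSemialgebraicFunOn ℚ S' G' →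
      Literature.NumberTheory.Transcendental.IsSemialgebraicMapOn ℚ S Φ →
      (∀ z ∈ S, (∀ i, |z i| ≤ N) ∧ |G z| ≤ N) → (∀ z ∈ S', (∀ i, |z i| ≤ N) ∧ |G' z| ≤ N) →
      (∀ t ∈ Set.Ioo (0:ℝ) 1,
        Set.InjOn (fun x : Fin n → ℝ => Φ (Fin.snoc x t)) {x | Fin.snoc x t ∈ S} ∧
        (fun x : Fin n → ℝ => Φ (Fin.snoc x t)) '' {x | Fin.snoc x t ∈ S} = {y | Fin.snoc y t ∈ S'} ∧
        ∀ x : Fin n → ℝ, Fin.snoc x t ∈ S → ∃ L : (Fin n → ℝ) →L[ℝ] (Fin n → ℝ),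
          HasFDerivWithinAt (fun x : Fin n → ℝ => Φ (Fin.snoc x t)) L {x | Fin.snoc x t ∈ S} x ∧
          G (Fin.snoc x t) = G' (Fin.snoc (Φ (Fin.snoc x t)) t) * |L.det|) →
      Literature.NumberTheory.Transcendental.IsSemialgebraicFunOn ℚ Set.univ g₀ →
      Literature.NumberTheory.Transcendental.IsSemialgebraicFunOn ℚ Set.univ g₀' →
      (∀ x : Fin n → ℝ, Filter.Tendsto
          (fun t : ℝ => {x : Fin n → ℝ | Fin.snoc x t ∈ S}.indicator (fun x => G (Fin.snoc x t)) x)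
          (𝓝[>] (0:ℝ)) (𝓝 (g₀ x))) →
      (∀ y : Fin n → ℝ, Filter.Tendsto
          (fun t : ℝ => {y : Fin n → ℝ | Fin.snoc y t ∈ S'}.indicator (fun y => G' (Fin.snoc y t)) y)
          (𝓝[>] (0:ℝ)) (𝓝 (g₀' y))) →
      ∃ (U : Set (Fin n → ℝ)) (ψ : (Fin n → ℝ) → (Fin n → ℝ))
        (ψ' : (Fin n → ℝ) → (Fin n → ℝ) →L[ℝ] (Fin n → ℝ)),
        IsOpen U ∧ Literature.ModelTheory.ExponentialFields.IsSemialgebraic ℚ U ∧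
        Literature.NumberTheory.Transcendental.IsSemialgebraicMapOn ℚ U ψ ∧
        Literature.NumberTheory.Transcendental.IsSemialgebraicFunOn ℚ U (fun x => (ψ' x).det) ∧
        (∀ x ∈ U, HasFDerivAt ψ (ψ' x) x) ∧ Set.InjOn ψ U ∧ (∀ x ∈ U, (ψ' x).det ≠ 0) ∧
        (∀ᵐ x ∂MeasureTheory.volume, x ∉ U → g₀ x = 0) ∧
        (∀ᵐ y ∂MeasureTheory.volume, y ∉ ψ '' U → g₀' y = 0) ∧
        (∀ᵐ x ∂MeasureTheory.volume, x ∈ U → g₀ x = g₀' (ψ x) * |(ψ' x).det|) := by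
  sorry

/-- **STUB 3 (`stub_aeCovAssembly`, size M) — an a.e.-change-of-variables configuration is a KZ-chain.**
If the extended integrands of `r₀`, `r₀'` have representatives `ρ`, `ρ'` and there is an open
`ℚ`-semialgebraic `U`, a `ℚ`-semialgebraic `ψ` differentiable and injective on `U` with `ℚ`-semialgebraic
non-vanishing Jacobian determinant, such that `ρ = 0` a.e. off `U`, `ρ' = 0` a.e. off `ψ '' U` and
`ρ = ρ' ∘ ψ · |det ψ'|` a.e. on `U`, then `KZ.Equivalent r₀ r₀'`: discard the null debris by domain
additivity and a.e.-congruence (landed `SpAeCongruence_proof`), and pass `(U, (1_{D'} f') ∘ ψ · |det ψ'|)` to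
`(ψ '' U, 1_{D'} f')` by ONE instance of `KZ.changeOfVariablesRel` (integrability on `U` from
`MeasureTheory.integrableOn_image_iff_integrableOn_abs_det_fderiv_smul`; null sets pull back under `ψ` by
`MeasureTheory.lintegral_image_eq_lintegral_abs_det_fderiv_mul` since `det ψ' ≠ 0`).
[Kontsevich–Zagier 2001, §1.2 rule (2); Mathlib `MeasureTheory.integral_image_eq_integral_abs_det_fderiv_smul`] -/
theorem stub_aeCovAssembly :
    ∀ ⦃n : ℕ⦄ (r₀ r₀' : Literature.NumberTheory.Transcendental.KZ.IntegralRep n)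
      (ρ ρ' : (Fin n → ℝ) → ℝ) (U : Set (Fin n → ℝ)) (ψ : (Fin n → ℝ) → (Fin n → ℝ))
      (ψ' : (Fin n → ℝ) → (Fin n → ℝ) →L[ℝ] (Fin n → ℝ)),
      r₀.domain.indicator r₀.integrand =ᵐ[MeasureTheory.volume] ρ →
      r₀'.domain.indicator r₀'.integrand =ᵐ[MeasureTheory.volume] ρ' →
      IsOpen U → Literature.ModelTheory.ExponentialFields.IsSemialgebraic ℚ U →
      Literature.NumberTheory.Transcendental.IsSemialgebraicMapOn ℚ U ψ →
      Literature.NumberTheory.Transcendental.IsSemialgebraicFunOn ℚ U (fun x => (ψ' x).det) →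
      (∀ x ∈ U, HasFDerivAt ψ (ψ' x) x) → Set.InjOn ψ U → (∀ x ∈ U, (ψ' x).det ≠ 0) →
      (∀ᵐ x ∂MeasureTheory.volume, x ∉ U → ρ x = 0) →
      (∀ᵐ y ∂MeasureTheory.volume, y ∉ ψ '' U → ρ' y = 0) →
      (∀ᵐ x ∂MeasureTheory.volume, x ∈ U → ρ x = ρ' (ψ x) * |(ψ' x).det|) →
      Literature.NumberTheory.Transcendental.KZ.Equivalent r₀ r₀' := by
  sorry

/-! ### Composition (no `sorry` below this line) -/

/-- **Composition (kernel-checked): the crux `TameCovLimit` BY NAME from the three stubs.** The `suffices`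
is the registered implication `<stub_pointwiseLimit> → <stub_goodLocus> → <stub_aeCovAssembly> → TameCovLimit`
(a closed term with no `sorry` of its own), applied to the three named stubs; its proof is pure logic:
pointwise limits `g₀, g₀'` of both families (stub 1, twice), the good locus `U, ψ, ψ'` (stub 2), and the
assembly of the chain with `ρ := g₀`, `ρ' := g₀'` (stub 3). [Kontsevich–Zagier 2001, §1.2] -/
theorem TameCovLimit_of : TameCovLimit := by
  suffices key :
      (∀ ⦃n : ℕ⦄ (N : ℕ) (S : Set (Fin (n + 1) → ℝ)) (G : (Fin (n + 1) → ℝ) → ℝ)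
        (r₀ : Literature.NumberTheory.Transcendental.KZ.IntegralRep n),
        Literature.ModelTheory.ExponentialFields.IsSemialgebraic ℚ S →
        Literature.NumberTheory.Transcendental.IsSemialgebraicFunOn ℚ S G →
        (∀ z ∈ S, (∀ i, |z i| ≤ N) ∧ |G z| ≤ N) →
        Filter.Tendsto (fun t : ℝ => ∫ x : Fin n → ℝ,
          |{x : Fin n → ℝ | Fin.snoc x t ∈ S}.indicator (fun x => G (Fin.snoc x t)) x
            - r₀.domain.indicator r₀.integrand x|) (𝓝[>] (0:ℝ)) (𝓝 0) →
        ∃ g₀ : (Fin n → ℝ) → ℝ,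
        Literature.NumberTheory.Transcendental.IsSemialgebraicFunOn ℚ Set.univ g₀ ∧
        (∀ x, |g₀ x| ≤ N) ∧ (∀ x, g₀ x ≠ 0 → ∀ i, |x i| ≤ N) ∧
        (∀ x : Fin n → ℝ, Filter.Tendsto
          (fun t : ℝ => {x : Fin n → ℝ | Fin.snoc x t ∈ S}.indicator (fun x => G (Fin.snoc x t)) x)
          (𝓝[>] (0:ℝ)) (𝓝 (g₀ x))) ∧
        r₀.domain.indicator r₀.integrand =ᵐ[MeasureTheory.volume] g₀) →
      (∀ ⦃n : ℕ⦄ (N : ℕ) (S S' : Set (Fin (n + 1) → ℝ)) (G G' : (Fin (n + 1) → ℝ) → ℝ)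
        (Φ : (Fin (n + 1) → ℝ) → (Fin n → ℝ)) (g₀ g₀' : (Fin n → ℝ) → ℝ),
        Literature.ModelTheory.ExponentialFields.IsSemialgebraic ℚ S →
        Literature.NumberTheory.Transcendental.IsSemialgebraicFunOn ℚ S G →
        Literature.ModelTheory.ExponentialFields.IsSemialgebraic ℚ S' →
        Literature.NumberTheory.Transcendental.IsSemialgebraicFunOn ℚ S' G' →
        Literature.NumberTheory.Transcendental.IsSemialgebraicMapOn ℚ S Φ →
        (∀ z ∈ S, (∀ i, |z i| ≤ N) ∧ |G z| ≤ N) → (∀ z ∈ S', (∀ i, |z i| ≤ N) ∧ |G' z| ≤ N) →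
        (∀ t ∈ Set.Ioo (0:ℝ) 1,
          Set.InjOn (fun x : Fin n → ℝ => Φ (Fin.snoc x t)) {x | Fin.snoc x t ∈ S} ∧
          (fun x : Fin n → ℝ => Φ (Fin.snoc x t)) '' {x | Fin.snoc x t ∈ S} = {y | Fin.snoc y t ∈ S'} ∧
          ∀ x : Fin n → ℝ, Fin.snoc x t ∈ S → ∃ L : (Fin n → ℝ) →L[ℝ] (Fin n → ℝ),
          HasFDerivWithinAt (fun x : Fin n → ℝ => Φ (Fin.snoc x t)) L {x | Fin.snoc x t ∈ S} x ∧
          G (Fin.snoc x t) = G' (Fin.snoc (Φ (Fin.snoc x t)) t) * |L.det|) →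
        Literature.NumberTheory.Transcendental.IsSemialgebraicFunOn ℚ Set.univ g₀ →
        Literature.NumberTheory.Transcendental.IsSemialgebraicFunOn ℚ Set.univ g₀' →
        (∀ x : Fin n → ℝ, Filter.Tendsto
          (fun t : ℝ => {x : Fin n → ℝ | Fin.snoc x t ∈ S}.indicator (fun x => G (Fin.snoc x t)) x)
          (𝓝[>] (0:ℝ)) (𝓝 (g₀ x))) →
        (∀ y : Fin n → ℝ, Filter.Tendsto
          (fun t : ℝ => {y : Fin n → ℝ | Fin.snoc y t ∈ S'}.indicator (fun y => G' (Fin.snoc y t)) y)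
          (𝓝[>] (0:ℝ)) (𝓝 (g₀' y))) →
        ∃ (U : Set (Fin n → ℝ)) (ψ : (Fin n → ℝ) → (Fin n → ℝ))
        (ψ' : (Fin n → ℝ) → (Fin n → ℝ) →L[ℝ] (Fin n → ℝ)),
        IsOpen U ∧ Literature.ModelTheory.ExponentialFields.IsSemialgebraic ℚ U ∧
        Literature.NumberTheory.Transcendental.IsSemialgebraicMapOn ℚ U ψ ∧
        Literature.NumberTheory.Transcendental.IsSemialgebraicFunOn ℚ U (fun x => (ψ' x).det) ∧
        (∀ x ∈ U, HasFDerivAt ψ (ψ' x) x) ∧ Set.InjOn ψ U ∧ (∀ x ∈ U, (ψ' x).det ≠ 0) ∧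
        (∀ᵐ x ∂MeasureTheory.volume, x ∉ U → g₀ x = 0) ∧
        (∀ᵐ y ∂MeasureTheory.volume, y ∉ ψ '' U → g₀' y = 0) ∧
        (∀ᵐ x ∂MeasureTheory.volume, x ∈ U → g₀ x = g₀' (ψ x) * |(ψ' x).det|)) →
      (∀ ⦃n : ℕ⦄ (r₀ r₀' : Literature.NumberTheory.Transcendental.KZ.IntegralRep n)
        (ρ ρ' : (Fin n → ℝ) → ℝ) (U : Set (Fin n → ℝ)) (ψ : (Fin n → ℝ) → (Fin n → ℝ))
        (ψ' : (Fin n → ℝ) → (Fin n → ℝ) →L[ℝ] (Fin n → ℝ)),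
        r₀.domain.indicator r₀.integrand =ᵐ[MeasureTheory.volume] ρ →
        r₀'.domain.indicator r₀'.integrand =ᵐ[MeasureTheory.volume] ρ' →
        IsOpen U → Literature.ModelTheory.ExponentialFields.IsSemialgebraic ℚ U →
        Literature.NumberTheory.Transcendental.IsSemialgebraicMapOn ℚ U ψ →
        Literature.NumberTheory.Transcendental.IsSemialgebraicFunOn ℚ U (fun x => (ψ' x).det) →
        (∀ x ∈ U, HasFDerivAt ψ (ψ' x) x) → Set.InjOn ψ U → (∀ x ∈ U, (ψ' x).det ≠ 0) →
        (∀ᵐ x ∂MeasureTheory.volume, x ∉ U → ρ x = 0) →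
        (∀ᵐ y ∂MeasureTheory.volume, y ∉ ψ '' U → ρ' y = 0) →
        (∀ᵐ x ∂MeasureTheory.volume, x ∈ U → ρ x = ρ' (ψ x) * |(ψ' x).det|) →
        Literature.NumberTheory.Transcendental.KZ.Equivalent r₀ r₀') →
      TameCovLimit from key stub_pointwiseLimit stub_goodLocus stub_aeCovAssembly
  intro h₁ h₂ h₃ n N S S' G G' Φ r₀ r₀' hS hG hS' hG' hΦ hb hb' hcov hL hL'
  -- pointwise (o-minimal) limits of both extended fibre integrands, identified with the L¹-endpoints
  obtain ⟨g₀, hg₀, -, -, hg₀t, hg₀ae⟩ := h₁ N S G r₀ hS hG hb hL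
  obtain ⟨g₀', hg₀', -, -, hg₀'t, hg₀'ae⟩ := h₁ N S' G' r₀' hS' hG' hb' hL'
  -- the good locus of the standard part of the family of change-of-variables instances
  obtain ⟨U, ψ, ψ', hU, hUsa, hψ, hdet, hder, hinj, hdet0, hoff, hoff', hcov₀⟩ :=
    h₂ N S S' G G' Φ g₀ g₀' hS hG hS' hG' hΦ hb hb' hcov hg₀ hg₀' hg₀t hg₀'t
  -- one honest change-of-variables move on the good locus plus null debris
  exact h₃ r₀ r₀' g₀ g₀' U ψ ψ' hg₀ae hg₀'ae hU hUsa hψ hdet hder hinj hdet0 hoff hoff' hcov₀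

end Summit.KontsevichZagierPeriods.KontsevichZagierPeriods.Cruxes.TameCovLimit.Birth

end
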